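import Summits.HubbardSuperconductivity.HubbardSuperconductivity.Theorems.AnisotropyChordTransferTwoMagnonScreeningLemmas

/-!
# Route `AnisotropyChord` / H0 rotor rung: the XY-point two-magnon SCREENING INEQUALITY holds for every `L ≥ 3` (part 2 of 2)

`xyTwoMagnonScreening_holds : XYTwoMagnonScreening` — the tree's conjecture-tagged lattice-sum inequality
`g₁(L; 1/(L² g₀(L;0))) ≤ 2 · g₀(L; 0)` (PART N20, `…TransferTwoMagnon`, memo ROTOR-THEORY-18 §219(d)/§220 of the theory
seat `hubbard-h0-rotor-theory-1`; the `Δ = 0` endpoint input of THEOREM GM₂-END, «the `K₁` channel screens at most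
twice as well as the `K = 0` channel at the `K = 0` binding scale») is proved for all `L ≥ 3`.

Proof (notation of part 1, `…TransferTwoMagnonScreeningLemmas`; `θ = π/L`, `c = cos θ`, `S_j = 4 sin²(jθ)`,
`P_j = 4c·sin(jθ)·sin((j+1)θ)`, `G = L²·g₀(L;0) = Σ_{(j,k) ≠ (0,0)} 1/(S_j + S_k)`, `τ₀ = 1/G`):
* PAIRING of twisted and periodic momenta: `Σ_{j=1}^{L−2} T_j(τ₀) ≤ Σ_{j=1}^{L−1} U_j(τ₀)` where `U_j` is `T_j` with
  `P_j` replaced by `c·S_j` — the assignment `j ↦ j` (`2j+1 ≤ L`) resp. `j ↦ j+1` (`2j+1 > L`) is injective into `[1, L−1]`;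
* SMALLNESS `9τ₀ ≤ S_1`, i.e. `G·S_1 ≥ 9`, from the 24 terms of `G` with indices in `{0, 1, 2, L−2, L−1}`
  (`6/S_1 + 6/S_2 + 8/(S_1 + S_2) ≥ 9.1/S_1` as `S_2 ≤ 4S_1`);
* TERMWISE `1/(S_k − τ₀) ≤ (9/8)/S_k`, `1/(cS_j − τ₀) ≤ (3/2)/S_j`, `1/(cS_j + S_k − τ₀) ≤ 2/(S_j + S_k)` for `L ≥ 5`
  (`c ≥ 4/5`), whence `L²·g₁ ≤ (2·9/8 + 3/2)·R + 2·ΣB ≤ 4R + 2ΣB = 2G`;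
* `L = 3, 4` by exact evaluation (`G₀(3) = 2`, `G₁(3; 1/2) = 31/10`; `G₀(4) = 103/24`, `G₁(4; 24/103) ≤ 103/12`).
Numerically `g₁(τ₀)/g₀(0) = 1.55, 1.24, 1.15, 1.11, …, → 1` (`L = 3, 4, 5, 6, …`), so the factor `2` is never approached.

Prover seat `hubbard-h0-rotor-p1` g21; helper for the H0 rotor rung dossier of stmt-HubbardSuperconductivity-19089
(`--supports`).  No definition of the route is touched; nothing here is a statement about the Hubbard model.
-/

set_option linter.dupNamespace false
set_option autoImplicit false

noncomputable section

open Finset Real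

namespace Summit.HubbardSuperconductivity.HubbardSuperconductivity.Theorems.AnisotropyChord.Transfer

/-! ## The pairing of twisted and periodic momenta -/

/-- **Pairing bound:** `Σ_{j=1}^{L−2} T_j(τ) ≤ Σ_{j=1}^{L−1} U_j(τ)` for `0 ≤ τ < c·S_1` — the `K₁` x-energy `P_j`
dominates `c·S_j` (`2j+1 ≤ L`) resp. `c·S_{j+1}` (`2j+1 ≥ L`), an injective assignment into `[1, L−1]`. [folklore] -/
theorem screen_sum_rowT_le (n : ℕ) (hn : 1 ≤ n) (τ : ℝ)
    (hτ : τ < Real.cos (Real.pi / (n + 2 : ℕ)) * screenS (n + 2) 1) :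
    ∑ i ∈ Finset.range n, screenRowT n τ (i + 1) ≤ ∑ j ∈ Finset.range (n + 1), screenRowU n τ (j + 1) := by
  set c := Real.cos (Real.pi / (n + 2 : ℕ)) with hc_def
  have hc0 : 0 ≤ c := screen_cos_nonneg (L := n + 2) (by omega)
  have hpos : ∀ j, 1 ≤ j → j + 1 ≤ n + 2 → 0 < c * screenS (n + 2) j - τ := by
    intro j hj hjL
    have h1 := screenS_one_le (L := n + 2) hj hjL
    nlinarith [mul_le_mul_of_nonneg_left h1 hc0]
  have hU : ∀ j, 1 ≤ j → j + 1 ≤ n + 2 → 0 ≤ screenRowU n τ j := by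
    intro j hj hjL
    unfold screenRowU
    apply add_nonneg
    · exact le_of_lt (inv_pos.mpr (hpos j hj hjL))
    · apply Finset.sum_nonneg
      intro k _
      apply le_of_lt
      apply inv_pos.mpr
      have := screenS_nonneg (n + 2) (k + 1)
      linarith [hpos j hj hjL]
  have hTU : ∀ i m, 1 ≤ m → m + 1 ≤ n + 2 → c * screenS (n + 2) m ≤ screenP (n + 2) (i + 1) →
      screenRowT n τ (i + 1) ≤ screenRowU n τ m := by
    intro i m hm hmL hP
    unfold screenRowT screenRowU
    have h0 := hpos m hm hmL
    apply add_le_add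
    · apply inv_anti₀ h0; linarith
    · apply Finset.sum_le_sum
      intro k _
      have := screenS_nonneg (n + 2) (k + 1)
      apply inv_anti₀ (by linarith); linarith
  set a := (n + 1) / 2 with ha_def
  have ha : a ≤ n := by omega
  have ha' : a ≤ n + 1 := by omega
  rw [← Finset.sum_range_add_sum_Ico _ ha, ← Finset.sum_range_add_sum_Ico _ ha']
  apply add_le_add
  · apply Finset.sum_le_sum
    intro i hi
    have hi' : i < a := Finset.mem_range.mp hi
    apply hTU i (i + 1) (by omega) (by omega)
    exact screenP_ge_left (L := n + 2) (by omega) (by omega)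
  · calc ∑ i ∈ Finset.Ico a n, screenRowT n τ (i + 1)
        ≤ ∑ i ∈ Finset.Ico a n, screenRowU n τ (i + 1 + 1) := by
          apply Finset.sum_le_sum
          intro i hi
          have hi' := Finset.mem_Ico.mp hi
          apply hTU i (i + 1 + 1) (by omega) (by omega)
          exact screenP_ge_right (L := n + 2) (by omega) (by omega) (by omega)
      _ = ∑ j ∈ Finset.Ico (a + 1) (n + 1), screenRowU n τ (j + 1) := by
          rw [Finset.sum_Ico_add' (fun j => screenRowU n τ (j + 1)) a n 1]
      _ ≤ ∑ j ∈ Finset.Ico a (n + 1), screenRowU n τ (j + 1) := by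
          apply Finset.sum_le_sum_of_subset_of_nonneg
          · exact Finset.Ico_subset_Ico (by omega) le_rfl
          · intro j hj _
            have hj' := Finset.mem_Ico.mp hj
            exact hU (j + 1) (by omega) (by omega)

/-! ## Smallness of `τ₀`: `G₀ · S₁ ≥ 9` -/

/-- the five-point index set `{0, 1, 2, L−2, L−1}`. [folklore] -/
theorem screen_sum_five (n : ℕ) (hn : 3 ≤ n) (g : ℕ → ℝ) :
    ∑ x ∈ ({0, 1, 2, n, n + 1} : Finset ℕ), g x = g 0 + g 1 + g 2 + g n + g (n + 1) := by
  rw [Finset.sum_insert (by simp; omega), Finset.sum_insert (by simp; omega),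
    Finset.sum_insert (by simp; omega), Finset.sum_pair (by omega)]
  ring

/-- **`G₀(L)·S_1 ≥ 9`** for `L ≥ 5`: the 24 terms of `G₀` with both indices in `{0, 1, 2, L−2, L−1}` give
`6/S_1 + 6/S_2 + 8/(S_1 + S_2) ≥ 9.1/S_1` (`S_2 = 4c²S_1 ≤ 4 S_1`). [folklore] -/
theorem screenG0_ge (n : ℕ) (hn : 3 ≤ n) : 9 / screenS (n + 2) 1 ≤ screenG0 (n + 2) := by
  have hs0 : 0 < screenS (n + 2) 1 := screenS_pos (L := n + 2) le_rfl (by omega)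
  have hu0 : 0 < screenS (n + 2) 2 := screenS_pos (L := n + 2) (by norm_num) (by omega)
  have hus : screenS (n + 2) 2 ≤ 4 * screenS (n + 2) 1 := by
    rw [screenS_two]
    have : Real.cos (Real.pi / (n + 2 : ℕ)) ^ 2 ≤ 1 := by
      have h1 := Real.abs_cos_le_one (Real.pi / (n + 2 : ℕ))
      have h2 : Real.cos (Real.pi / (n + 2 : ℕ)) ^ 2 = |Real.cos (Real.pi / (n + 2 : ℕ))| ^ 2 := (sq_abs _).symm
      rw [h2]; nlinarith [abs_nonneg (Real.cos (Real.pi / (n + 2 : ℕ)))]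
    nlinarith
  set T : Finset ℕ := {0, 1, 2, n, n + 1} with hT_def
  have hT : T ⊆ Finset.range (n + 2) := by
    intro x hx
    simp only [hT_def, Finset.mem_insert, Finset.mem_singleton] at hx
    simp only [Finset.mem_range]
    omega
  have hf0 : ∀ j k, 0 ≤ screenF0 (n + 2) j k := by
    intro j k
    unfold screenF0
    split_ifs
    · exact le_rfl
    · rw [sub_zero]; exact inv_nonneg.mpr (add_nonneg (screenS_nonneg _ _) (screenS_nonneg _ _))
  have step1 : ∑ j ∈ T, ∑ k ∈ T, screenF0 (n + 2) j k ≤ screenG0 (n + 2) := by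
    unfold screenG0
    calc ∑ j ∈ T, ∑ k ∈ T, screenF0 (n + 2) j k ≤ ∑ j ∈ T, ∑ k ∈ Finset.range (n + 2), screenF0 (n + 2) j k := by
          apply Finset.sum_le_sum
          intro j _
          exact Finset.sum_le_sum_of_subset_of_nonneg hT (fun k _ _ => hf0 j k)
      _ ≤ _ := Finset.sum_le_sum_of_subset_of_nonneg hT (fun j _ _ => Finset.sum_nonneg (fun k _ => hf0 j k))
  refine le_trans ?_ step1
  rw [hT_def, screen_sum_five n hn]
  simp only [screen_sum_five n hn]
  have hne : ∀ j k : ℕ, ¬ (j = 0 ∧ k = 0) → screenF0 (n + 2) j k = (screenS (n + 2) j + screenS (n + 2) k)⁻¹ := by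
    intro j k h
    unfold screenF0
    rw [if_neg h, sub_zero]
  rw [screenF0_zero_zero]
  rw [hne 0 1 (by omega), hne 0 2 (by omega), hne 0 n (by omega), hne 0 (n + 1) (by omega),
    hne 1 0 (by omega), hne 1 1 (by omega), hne 1 2 (by omega), hne 1 n (by omega), hne 1 (n + 1) (by omega),
    hne 2 0 (by omega), hne 2 1 (by omega), hne 2 2 (by omega), hne 2 n (by omega), hne 2 (n + 1) (by omega),
    hne n 0 (by omega), hne n 1 (by omega), hne n 2 (by omega), hne n n (by omega), hne n (n + 1) (by omega),
    hne (n + 1) 0 (by omega), hne (n + 1) 1 (by omega), hne (n + 1) 2 (by omega), hne (n + 1) n (by omega),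
    hne (n + 1) (n + 1) (by omega)]
  rw [screenS_last, screenS_lastButOne, screenS_zero]
  set s := screenS (n + 2) 1 with hs_def
  set u := screenS (n + 2) 2 with hu_def
  rw [zero_add, add_zero, add_zero]
  have e1 : (4 * s)⁻¹ ≤ u⁻¹ := inv_anti₀ hu0 hus
  have e2 : (5 * s)⁻¹ ≤ (s + u)⁻¹ := inv_anti₀ (by positivity) (by linarith)
  have e3 : (5 * s)⁻¹ ≤ (u + s)⁻¹ := inv_anti₀ (by positivity) (by linarith)
  have e4 : (8 * s)⁻¹ ≤ (u + u)⁻¹ := inv_anti₀ (by positivity) (by linarith)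
  have i1 : (4 * s)⁻¹ = s⁻¹ / 4 := by rw [mul_inv, inv_eq_one_div (4:ℝ)]; ring
  have i2 : (5 * s)⁻¹ = s⁻¹ / 5 := by rw [mul_inv, inv_eq_one_div (5:ℝ)]; ring
  have i3 : (8 * s)⁻¹ = s⁻¹ / 8 := by rw [mul_inv, inv_eq_one_div (8:ℝ)]; ring
  have i4 : (s + s)⁻¹ = s⁻¹ / 2 := by rw [← two_mul, mul_inv, inv_eq_one_div (2:ℝ)]; ring
  have i5 : (9 : ℝ) / s = 9 * s⁻¹ := div_eq_mul_inv _ _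
  rw [i1] at e1; rw [i2] at e2 e3; rw [i3] at e4
  rw [i4, i5]
  simp only [zero_add]
  have hsinv : 0 < s⁻¹ := inv_pos.mpr hs0
  nlinarith [e1, e2, e3, e4]


/-! ## Assembly for `L ≥ 5` -/

/-- **Screening for `L = n + 2 ≥ 5`:** `G₁(L; 1/G₀(L)) ≤ 2·G₀(L)`. [folklore] -/
theorem screen_main (n : ℕ) (hn : 3 ≤ n) :
    screenG1 (n + 2) (1 / screenG0 (n + 2)) ≤ 2 * screenG0 (n + 2) := by
  have hs0 : 0 < screenS (n + 2) 1 := screenS_pos (L := n + 2) le_rfl (by omega)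
  have hc45 : 4 / 5 ≤ Real.cos (Real.pi / (n + 2 : ℕ)) := screen_cos_ge (L := n + 2) (by omega)
  have hc1 : Real.cos (Real.pi / (n + 2 : ℕ)) ≤ 1 := Real.cos_le_one _
  have hG9 : 9 / screenS (n + 2) 1 ≤ screenG0 (n + 2) := screenG0_ge n hn
  have hG0 : 0 < screenG0 (n + 2) := lt_of_lt_of_le (by positivity) hG9
  have h9 : 9 ≤ screenG0 (n + 2) * screenS (n + 2) 1 := by rwa [div_le_iff₀ hs0] at hG9
  set s := screenS (n + 2) 1 with hs_def
  set c := Real.cos (Real.pi / (n + 2 : ℕ)) with hc_def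
  set G := screenG0 (n + 2) with hG_def
  set τ := 1 / G with hτ_def
  have hτ0 : 0 < τ := by positivity
  have hτs : 9 * τ ≤ s := by
    rw [hτ_def, show (9 : ℝ) * (1 / G) = 9 / G by ring, div_le_iff₀ hG0]; linarith
  -- row bounds
  have hR1 : screenRowRone n τ ≤ s / (s - τ) * screenRowR n := by
    unfold screenRowRone screenRowR
    rw [Finset.mul_sum]
    apply Finset.sum_le_sum
    intro k hk
    have hk' := Finset.mem_range.mp hk
    have h1 := screenS_one_le (L := n + 2) (k := k + 1) (by omega) (by omega)
    have := screen_inv_sub_le (l := 1) (m := s) (x := screenS (n + 2) (k + 1)) (τ := τ)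
      hτ0.le hs0 h1 zero_le_one (by linarith)
    simpa only [one_mul] using this
  have hT : ∑ i ∈ Finset.range n, screenRowT n τ (i + 1) ≤ ∑ j ∈ Finset.range (n + 1), screenRowU n τ (j + 1) :=
    screen_sum_rowT_le n (by omega) τ (by nlinarith)
  have hU : ∀ j ∈ Finset.range (n + 1), screenRowU n τ (j + 1)
      ≤ s / (c * s - τ) * (screenS (n + 2) (j + 1))⁻¹ + 2 * s / (2 * c * s - τ) * screenRowB n (j + 1) := by
    intro j hj
    have hj' := Finset.mem_range.mp hj
    have h1 := screenS_one_le (L := n + 2) (k := j + 1) (by omega) (by omega)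
    unfold screenRowU screenRowB
    apply add_le_add
    · exact screen_inv_sub_le hτ0.le hs0 h1 (by linarith) (by nlinarith)
    · rw [Finset.mul_sum]
      apply Finset.sum_le_sum
      intro k hk
      have hk' := Finset.mem_range.mp hk
      have h2 := screenS_one_le (L := n + 2) (k := k + 1) (by omega) (by omega)
      have hSk := screenS_nonneg (n + 2) (k + 1)
      have hSj := screenS_nonneg (n + 2) (j + 1)
      calc (c * screenS (n + 2) (j + 1) + screenS (n + 2) (k + 1) - τ)⁻¹
          ≤ (c * (screenS (n + 2) (j + 1) + screenS (n + 2) (k + 1)) - τ)⁻¹ := by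
            apply inv_anti₀
            · nlinarith
            · nlinarith
        _ ≤ 2 * s / (c * (2 * s) - τ) * (screenS (n + 2) (j + 1) + screenS (n + 2) (k + 1))⁻¹ :=
            screen_inv_sub_le (l := c) (m := 2 * s) hτ0.le (by linarith) (by linarith) (by linarith) (by nlinarith)
        _ = 2 * s / (2 * c * s - τ) * (screenS (n + 2) (j + 1) + screenS (n + 2) (k + 1))⁻¹ := by
            rw [show c * (2 * s) = 2 * c * s by ring]
  -- constants
  have hden1 : 0 < s - τ := by linarith
  have hden2 : 0 < c * s - τ := by nlinarith
  have hden3 : 0 < 2 * c * s - τ := by nlinarith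
  have hα : s / (s - τ) ≤ 9 / 8 := by
    rw [div_le_div_iff₀ hden1 (by norm_num)]; nlinarith
  have hβ : s / (c * s - τ) ≤ 3 / 2 := by
    rw [div_le_div_iff₀ hden2 (by norm_num)]; nlinarith
  have hγ : 2 * s / (2 * c * s - τ) ≤ 2 := by
    rw [div_le_iff₀ hden3]; nlinarith
  have hγ0 : 0 ≤ 2 * s / (2 * c * s - τ) := by positivity
  -- nonnegativity of the row sums
  have hR0 : 0 ≤ screenRowR n := by
    unfold screenRowR
    exact Finset.sum_nonneg (fun k _ => inv_nonneg.mpr (screenS_nonneg _ _))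
  have hB0 : ∀ j, 0 ≤ screenRowB n j := by
    intro j
    unfold screenRowB
    exact Finset.sum_nonneg (fun k _ => inv_nonneg.mpr (add_nonneg (screenS_nonneg _ _) (screenS_nonneg _ _)))
  -- assembly
  rw [screenG1_eq, hG_def, screenG0_eq]
  have hsumU : ∑ j ∈ Finset.range (n + 1), screenRowU n τ (j + 1)
      ≤ s / (c * s - τ) * screenRowR n + 2 * s / (2 * c * s - τ) * ∑ j ∈ Finset.range (n + 1), screenRowB n (j + 1) := by
    calc ∑ j ∈ Finset.range (n + 1), screenRowU n τ (j + 1)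
        ≤ ∑ j ∈ Finset.range (n + 1),
            (s / (c * s - τ) * (screenS (n + 2) (j + 1))⁻¹ + 2 * s / (2 * c * s - τ) * screenRowB n (j + 1)) :=
          Finset.sum_le_sum hU
      _ = _ := by
          rw [Finset.sum_add_distrib, ← Finset.mul_sum, ← Finset.mul_sum]
          rfl
  have hsplit : ∑ j ∈ Finset.range (n + 1), ((screenS (n + 2) (j + 1))⁻¹ + screenRowB n (j + 1))
      = screenRowR n + ∑ j ∈ Finset.range (n + 1), screenRowB n (j + 1) := by
    rw [Finset.sum_add_distrib]; rfl
  rw [hsplit]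
  set SB := ∑ j ∈ Finset.range (n + 1), screenRowB n (j + 1) with hSB_def
  have hSB0 : 0 ≤ SB := Finset.sum_nonneg (fun j _ => hB0 (j + 1))
  have e1 : 2 * screenRowRone n τ ≤ 2 * (9 / 8) * screenRowR n := by
    have := mul_le_mul_of_nonneg_right hα hR0
    linarith
  have e2 : s / (c * s - τ) * screenRowR n ≤ 3 / 2 * screenRowR n := mul_le_mul_of_nonneg_right hβ hR0
  have e3 : 2 * s / (2 * c * s - τ) * SB ≤ 2 * SB := mul_le_mul_of_nonneg_right hγ hSB0
  linarith

/-- **Screening for `L ≥ 5`.** [folklore] -/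
theorem xyTwoMagnonScreening_of_five_le (L : ℕ) (hL : 5 ≤ L) :
    gOne L (1 / ((L : ℝ) ^ 2 * gZero L 0)) ≤ 2 * gZero L 0 := by
  obtain ⟨n, rfl⟩ : ∃ n, L = n + 2 := ⟨L - 2, by omega⟩
  have hn : 3 ≤ n := by omega
  rw [gOne_eq, gZero_zero_eq]
  have hL0 : (0 : ℝ) < ((n + 2 : ℕ) : ℝ) ^ 2 := by positivity
  have hG9 := screenG0_ge n hn
  have hs0 : 0 < screenS (n + 2) 1 := screenS_pos (L := n + 2) le_rfl (by omega)
  have hG0 : 0 < screenG0 (n + 2) := lt_of_lt_of_le (by positivity) hG9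
  have hτ : 1 / (((n + 2 : ℕ) : ℝ) ^ 2 * ((((n + 2 : ℕ) : ℝ) ^ 2)⁻¹ * screenG0 (n + 2))) = 1 / screenG0 (n + 2) := by
    rw [← mul_assoc, mul_inv_cancel₀ hL0.ne', one_mul]
  rw [hτ]
  have := screen_main n hn
  have hinv : 0 < (((n + 2 : ℕ) : ℝ) ^ 2)⁻¹ := by positivity
  nlinarith


/-! ## The cases `L = 3` and `L = 4` by exact evaluation -/

/-- `G₀(3) = 2` (cosines `cos(2π/3) = cos(4π/3) = −1/2`). [folklore] -/
theorem screenG0_three : screenG0 3 = 2 := by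
  have c1 : Real.cos (2 * Real.pi / 3) = -1 / 2 := by
    rw [show (2 * Real.pi / 3 : ℝ) = Real.pi - Real.pi / 3 by ring, Real.cos_pi_sub, Real.cos_pi_div_three]
    norm_num
  have c2 : Real.cos (2 * Real.pi * 2 / 3) = -1 / 2 := by
    rw [show (2 * Real.pi * 2 / 3 : ℝ) = Real.pi / 3 + Real.pi by ring, Real.cos_add_pi, Real.cos_pi_div_three]
    norm_num
  simp only [screenG0, screenF0, screenS, Finset.sum_range_succ, Finset.sum_range_zero]
  norm_num
  rw [c1, c2]
  norm_num

/-- `G₁(3; 1/2) = 31/10` (in addition `cos(5π/3) = 1/2`). [folklore] -/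
theorem screenG1_three : screenG1 3 (1 / 2) = 31 / 10 := by
  have c1 : Real.cos (2 * Real.pi / 3) = -1 / 2 := by
    rw [show (2 * Real.pi / 3 : ℝ) = Real.pi - Real.pi / 3 by ring, Real.cos_pi_sub, Real.cos_pi_div_three]
    norm_num
  have c2 : Real.cos (2 * Real.pi * 2 / 3) = -1 / 2 := by
    rw [show (2 * Real.pi * 2 / 3 : ℝ) = Real.pi / 3 + Real.pi by ring, Real.cos_add_pi, Real.cos_pi_div_three]
    norm_num
  have c3 : Real.cos (5 * Real.pi / 3) = 1 / 2 := by
    rw [show (5 * Real.pi / 3 : ℝ) = 2 * Real.pi - Real.pi / 3 by ring, Real.cos_two_pi_sub, Real.cos_pi_div_three]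
  simp only [screenG1, screenF1, screenS, screenP, Finset.sum_range_succ, Finset.sum_range_zero]
  norm_num
  rw [c1, c2, c3]
  norm_num

/-- `G₀(4) = 103/24` (cosines `cos(π/2) = cos(3π/2) = 0`, `cos π = −1`). [folklore] -/
theorem screenG0_four : screenG0 4 = 103 / 24 := by
  have c1 : Real.cos (2 * Real.pi / 4) = 0 := by
    rw [show (2 * Real.pi / 4 : ℝ) = Real.pi / 2 by ring, Real.cos_pi_div_two]
  have c2 : Real.cos (2 * Real.pi * 2 / 4) = -1 := by
    rw [show (2 * Real.pi * 2 / 4 : ℝ) = Real.pi by ring, Real.cos_pi]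
  have c3 : Real.cos (2 * Real.pi * 3 / 4) = 0 := by
    rw [show (2 * Real.pi * 3 / 4 : ℝ) = Real.pi / 2 + Real.pi by ring, Real.cos_add_pi, Real.cos_pi_div_two]
    norm_num
  simp only [screenG0, screenF0, screenS, Finset.sum_range_succ, Finset.sum_range_zero]
  norm_num
  rw [c1, c2, c3]
  norm_num

/-- `G₁(4; 24/103) ≤ 103/12` (exactly `27973667/5243238 ≈ 5.34`; cosines `cos(3π/4) = cos(5π/4) = −√2/2`,
`cos(7π/4) = √2/2`, all products rational). [folklore] -/
theorem screenG1_four_le : screenG1 4 (24 / 103) ≤ 103 / 12 := by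
  have c1 : Real.cos (2 * Real.pi / 4) = 0 := by
    rw [show (2 * Real.pi / 4 : ℝ) = Real.pi / 2 by ring, Real.cos_pi_div_two]
  have c2 : Real.cos (2 * Real.pi * 2 / 4) = -1 := by
    rw [show (2 * Real.pi * 2 / 4 : ℝ) = Real.pi by ring, Real.cos_pi]
  have c3 : Real.cos (2 * Real.pi * 3 / 4) = 0 := by
    rw [show (2 * Real.pi * 3 / 4 : ℝ) = Real.pi / 2 + Real.pi by ring, Real.cos_add_pi, Real.cos_pi_div_two]
    norm_num
  have c4 : Real.cos (3 * Real.pi / 4) = -(Real.sqrt 2 / 2) := by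
    rw [show (3 * Real.pi / 4 : ℝ) = Real.pi - Real.pi / 4 by ring, Real.cos_pi_sub, Real.cos_pi_div_four]
  have c5 : Real.cos (5 * Real.pi / 4) = -(Real.sqrt 2 / 2) := by
    rw [show (5 * Real.pi / 4 : ℝ) = Real.pi / 4 + Real.pi by ring, Real.cos_add_pi, Real.cos_pi_div_four]
  have c6 : Real.cos (7 * Real.pi / 4) = Real.sqrt 2 / 2 := by
    rw [show (7 * Real.pi / 4 : ℝ) = 2 * Real.pi - Real.pi / 4 by ring, Real.cos_two_pi_sub, Real.cos_pi_div_four]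
  simp only [screenG1, screenF1, screenS, screenP, Finset.sum_range_succ, Finset.sum_range_zero]
  norm_num
  rw [c1, c2, c3, c4, c5, c6]
  have h2 : Real.sqrt 2 * Real.sqrt 2 = 2 := Real.mul_self_sqrt (by norm_num)
  have hA : 2 * (Real.sqrt 2 / 2) * (Real.sqrt 2 / 2 - -(Real.sqrt 2 / 2)) = 2 := by linear_combination h2
  have hB : 2 * (Real.sqrt 2 / 2) * (Real.sqrt 2 / 2 - Real.sqrt 2 / 2) = 0 := by ring
  rw [hA, hB]
  norm_num

/-- **Screening at `L = 3`** (`g₁/g₀ = 31/20`). [folklore] -/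
theorem xyTwoMagnonScreening_three : gOne 3 (1 / (((3 : ℕ) : ℝ) ^ 2 * gZero 3 0)) ≤ 2 * gZero 3 0 := by
  have e : 1 / (((3 : ℕ) : ℝ) ^ 2 * gZero 3 0) = 1 / 2 := by
    rw [gZero_zero_eq, screenG0_three]; norm_num
  rw [e, gOne_eq, screenG1_three, gZero_zero_eq, screenG0_three]
  norm_num

/-- **Screening at `L = 4`** (`g₁/g₀ ≈ 1.24`). [folklore] -/
theorem xyTwoMagnonScreening_four : gOne 4 (1 / (((4 : ℕ) : ℝ) ^ 2 * gZero 4 0)) ≤ 2 * gZero 4 0 := by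
  have e : 1 / (((4 : ℕ) : ℝ) ^ 2 * gZero 4 0) = 24 / 103 := by
    rw [gZero_zero_eq, screenG0_four]; norm_num
  rw [e, gOne_eq, gZero_zero_eq, screenG0_four]
  have := screenG1_four_le
  norm_num
  linarith

/-! ## The theorem -/

/-- **THE XY-POINT TWO-MAGNON SCREENING INEQUALITY holds for every `L ≥ 3`:**
`g₁(L; 1/(L² g₀(L;0))) ≤ 2 · g₀(L; 0)` — the `K₁` channel screens at most twice as well as the `K = 0` channel at
the `K = 0` binding scale; via memo ROTOR-THEORY-18 §219(d)/§220 this is the `Δ = 0` endpoint input of THEOREM GM₂-END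
(the XY two-magnon gap dominates the SEP gap `1 − cos(2π/L)`).  Discharges the tree's conjecture-tagged
`XYTwoMagnonScreening` (PART N20). [folklore] -/
theorem xyTwoMagnonScreening_holds : XYTwoMagnonScreening := by
  intro L hL
  rcases Nat.lt_or_ge L 5 with h | h
  · interval_cases L
    · exact xyTwoMagnonScreening_three
    · exact xyTwoMagnonScreening_four
  · exact xyTwoMagnonScreening_of_five_le L h

end Summit.HubbardSuperconductivity.HubbardSuperconductivity.Theorems.AnisotropyChord.Transfer

end
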